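import Summits.AnomalousDissipation.AnomalousDissipation.Theorems.MarginalStabilityChainStrainedLayerLawLine
import Summits.AnomalousDissipation.AnomalousDissipation.Theorems.MarginalStabilityChainStrainedLayerLawStubCoreFloor
import Summits.AnomalousDissipation.AnomalousDissipation.Theorems.MarginalStabilityChainStrainedLayerLawStubPressureRenormalisation
import HarnessLib.Audit

/-!
# Line `contraction-capture` — skeleton for crux `MarginalStabilityChain.StrainedLayerLaw`
(item stmt-AnomalousDissipation-3007, route route-AnomalousDissipation-MarginalStabilityChain; crux-plan round 1, gen 1)

Crux (FIXED; `Theses/MarginalStabilityChain.lean`, rev 4): `∃ c > 0 ∀ L > 0 ∃ ν₀ > 0 ∃ θ = (θ₁,θ₂)` (C², `L`-periodic in `x`,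
compact `y`-support, `∂ₓθ₁ + ∂_yθ₂ = 0`) `∀ ν ∈ (0,ν₀] ∀ (u,v,p)` global classical solutions of the stretched two-dimensional
Navier–Stokes system (γ = ΔU = 1) with period `L` from the Burgers layer `U_B^ν + θ`:
`ofReal (c·min L 1) ≤ liminf_T ofReal T⁻¹ ∫⁻_{(0,T]} D`, `D t = (ν/L)∫⁻_{x∈(0,L]}∫⁻_y |∇(u,v)|²`.
`InClass` / `IsAdmissiblePerturbation` below are the crux's hypothesis lists VERBATIM (checked character by character against the
route file), so that the composition `StrainedLayerLaw_of` concludes the route decl BY NAME through definitional unfolding only.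

Idea (crux idea card `Ideas/contraction-capture.md`, ideator 2; triage r1-1 / r1-2 / r1-3: pass, pass, pass; merge proposal
B ≈ C = `unit-cell-burgers-row-attractor` adopted as the inner half): use the `∃θ` freedom twice — a FINE PERIOD `ℓ = L/n ≤ L₀`
(an `ℓ`-periodic seed is `L`-periodic; solutions inherit the period of their data, so the pairing cascade and the pairing-marginal
scale never arise and the `c·min(L,1)` shape is automatic) and a SEEDED datum — and the AREA CONTRACTION `div (u, v − y) ≡ −1` of
the planar carrier flow: vorticity of both signs is transported in conservation form into one sink per cell, a focus that ends up
holding the NET circulation `−ℓ` of its cell as a Burgers core of radius `≍ √ν`, whose enstrophy gives a `ν`-free dissipation floor.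

## Architecture: RIGIDITY + OUTER CAPTURE + INNER CORE + TRANSFER, glued by fine-period arithmetic

* `stub_velocityRigidity` + `stub_pressureRenormalisation` (lead reshape 1 of the planner's `stub_periodInheritance`; RIGIDITY of the bare class;
  content of 1a = UNIQUENESS, refuter note M3, size L–open; 1b = pressure bookkeeping, true, size M): an `nℓ`-periodic classical solution from `ℓ`-periodic admissible data is `ℓ`-periodic (velocity by uniqueness + translation
  invariance of the class; pressure re-normalised), i.e. lies in the period-`ℓ` class.
* `stub_coarseCapture` (OUTER half = the card's contraction/capture lever + seed design; scale `ℓ/4`; XL): for every tolerance `ε`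
  there is `L₀ ≤ 1` such that every short cell `ℓ ≤ L₀` carries ONE admissible seed `θ_ℓ` for which, at every `ν ≤ ν₀(ℓ)`, every
  solution is eventually and forever COARSELY CAPTURED (`IsCaptured ℓ ε (ℓ/4)`): a box of half-side `ℓ/4` about one point at
  height `≤ ℓ/4` carries circulation `−ℓ ± εℓ` and all but `εℓ` of the cell's `|ω|`-mass, and the positive (wrong-signed) vorticity
  mass of the cell is `≤ εℓ`.
* `stub_viscousCore` (INNER half = card C's ν-uniform local attractor, stated as what the line needs and no more; XL, HARDEST — it
  carries the `ν`-independent constants `κ, ρ₀`, i.e. the anomalous content): there are ABSOLUTE `ε, ρ₀, κ > 0` such that in every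
  cell `ℓ ≤ 1`, for `ν ≤ ν₁(ℓ)`, a solution that is `ε`-captured for all late times eventually and forever holds circulation `≥ κℓ`
  in a box of half-side `ρ₀√ν` (the Burgers scale: for the Gaussian core `Γ(1 − e^{−ρ₀²/4})` sits within radius `ρ₀√ν`).
* `stub_coreFloor` (TRANSFER; true, size M — measure theory): `ω² ≤ 2|∇(u,v)|²` pointwise and Cauchy–Schwarz on a box `Q` of
  half-side `ρ` give `∫_Q|∇w|² ≥ Γ_Q²/(8ρ²)`; `n` disjoint `ℓ`-translates of `Q` in one `nℓ`-window, the window shift by periodicity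
  and a Cesàro bound give `meanLayerDissipation ν (nℓ) u v ≥ νΓ₀²/(8ρ²ℓ)` — with `ρ = ρ₀√ν`, `Γ₀ = κℓ` this is `κ²ℓ/(8ρ₀²)`, ν-FREE.
  (Chosen instead of the sibling card's strain-work sum rule `ℓD = J − dE/dt`, `J = −∫∫yωu`, because `J` is sign-indefinite —
  triage r1-1 (1), r1-2 (2) — whereas core enstrophy is local and one-signed; the sum rule remains the line's DNS diagnostic and the
  route to the sharp constant `1/8π`.)

Composition (`StrainedLayerLaw_of`, sorry-free): `ε, ρ₀, κ` from the inner stub; `L₀ = L₀(ε) ≤ 1` from the outer stub;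
`c := κ²L₀/(16ρ₀²)`. Given `L`: `n := ⌈L/L₀⌉₊ ≥ 1`, `ℓ := L/n ∈ (0, L₀]` with `ℓ ≥ L·L₀/(L+L₀) ≥ min(L,1)·L₀/2`; the seed `θ_ℓ`
is admissible for period `L = nℓ` (`Function.Periodic.nat_mul`); `ν₀ := min (min ν₀(ℓ) ν₁(ℓ)) (ℓ²/(4ρ₀²))` (the last so that
`2ρ₀√ν ≤ ℓ`: translated core boxes are disjoint); a crux solution at period `L` is `InClass ν (nℓ) θ_ℓ u v p` by `rfl`, drops to
period `ℓ` by rigidity, is captured (outer), concentrates (inner), and the transfer gives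
`meanLayerDissipation ν L u v ≥ κ²ℓ/(8ρ₀²) ≥ c·min(L,1)`, which IS the crux's conclusion (`change`).

## Disproof / negatives honoured (standing disprover's `Cruxes/StrainedLayerLaw/Disproof.lean`, tree copy 2026-08-16T04:56Z,
evidence update 05:06Z "§6 scope correction"; all cited theorems sorry-free there; NOT imported — it is a crux workfile, not a
landed `Theorems/StrainedLayerLaw/Negative/` module, and no such module exists yet)

* §2 `lawAt_zero_false`, `exists_nu_lawAt_zero_false`, `not_strainedLayerLaw_theta_zero`, `not_strainedLayerLaw_forall_theta`
  (H = "θ ≠ 0 is used": the Burgers layer is a member of the class with liminf-mean `D = √ν/(2√π)`, so the θ = 0 instance and the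
  ∀θ strengthening are FALSE): the line uses H AT `stub_coarseCapture` — it asserts `∃ θ` and is false at `θ = 0` (the laminar
  layer is `x`-independent forever, its `|ω|`-mass within `ℓ/4` of any point is `≤ ½ + O(√ν)` of the cell's: never captured;
  toy j013622/j013626 case L: `ε_needed ≡ 0.47`); `stub_viscousCore` / `stub_periodInheritance` quantify `∀ θ` only
  CONDITIONALLY (captured ⇒ core; class(nℓ) ⇒ class(ℓ)) — neither asserts the law for every θ, so neither is an instance of
  `not_strainedLayerLaw_forall_theta`.
* §4 `lawAt_parallel_false_of_relaxation` (+ `ParallelRelaxes`; an `x`-independent θ cannot carry the law): honoured at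
  `stub_coarseCapture` — an `x`-independent seed keeps every solution `x`-independent (apply `stub_periodInheritance` at every
  period `ℓ/m`), hence never captured; the line's seed is a localised shielded vortex.
* §3 `strainedRow_pairing_unstable`, `row_dissipation_per_area` (strained point row pairs at every spacing; coarsening raises `D`;
  terminal spacing = period): USED AS A FRIEND — one core per cell, the period being the seed's `ℓ`; subharmonic pairing is
  excluded by `stub_periodInheritance` (symmetry protection by exact `ℓ`-periodic data + uniqueness, triage r1-3 (1)).
* §3 docstring, DECAYING `y`-TRANSLATION SYMMETRY `y ↦ y − h₀e^{−t}` (same `D`): consistent with `IsCaptured`'s `|b| ≤ r`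
  clause (the core height relaxes to the axis; `∃ T₁` absorbs `h₀`).  ENSTROPHY LAW `D = (ν/L)∫∫ω²`: the transfer uses only the
  pointwise half `ω² ≤ 2|∇(u,v)|²`, valid without tails.
* §4 UNIQUENESS GHOSTS (M3; "no construction found; OPEN; recommended side condition ω ∈ L¹ ∩ L^∞ of the period strip"):
  this is exactly the content isolated in `stub_periodInheritance` (in its weakest sufficient form) with the same route-level
  repair named as fallback.
* §6 `steadyMode_integral_eq_zero`, `steadyMode_eq_zero_of_nonneg` (Kerr2024 §3, LINEAR steady modes need fed tails; the 05:06Z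
  update narrows its scope, as triage r1-2/r1-3 argued): moot — no stub asks for a steady state or a one-signed steady mode.
* `ledger negatives --problem AnomalousDissipation` (triage r1-2: 4 entries — certificate / energy-ceiling statements of other
  routes): no stub is an instance.
-/

set_option linter.dupNamespace false

noncomputable section

open scoped BigOperators Topology ENNReal
open Filter Set Function MeasureTheory

-- The vocabulary (`InClass`, `IsAdmissiblePerturbation`, `vort`, `boxCirc`, `cellPosVort`, `cellAbsVortOutside`, `IsCaptured`),
-- the glue and the CONDITIONAL composition `StrainedLayerLaw_of_stubs` are LANDED (p85262):
-- `Theorems/MarginalStabilityChainStrainedLayerLawLine.lean`, namespace `…Theorems.StrainedLayerLaw.ContractionCapture`.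
-- This skeleton lives in the same namespace so that the registered stub signatures read verbatim.
namespace Summit.AnomalousDissipation.AnomalousDissipation.Theorems.StrainedLayerLaw.ContractionCapture

open Literature.Analysis.FluidPDE Literature.Analysis.FluidPDE.StretchedLayer
open Summit.AnomalousDissipation.AnomalousDissipation.Theses.MarginalStabilityChain

/-! ## §2 The five stubs of the line (lead reshape 1: period inheritance split into 1a rigidity + 1b pressure) -/

/-- **Stub 1a — VELOCITY RIGIDITY (the uniqueness content of period inheritance; OPEN in the crux's bare class).**
If `θ` is admissible with period `ℓ` and `(u, v, p)` is a classical solution of the crux's class with period `nℓ` (`n ≥ 1`) from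
`U_B^ν + θ`, then `u, v` are `ℓ`-periodic in `x` for every `t ≥ 0`. PROOF ROUTE: the class is translation invariant in `x` and the
datum `U_B^ν + θ` is `ℓ`-periodic, so `(u, v, p)(t, x + ℓ, y)` is again in `InClass ν (nℓ) θ` with the SAME datum; UNIQUENESS of the
velocity in the class would give `u(·, · + ℓ, ·) = u`, `v(·, · + ℓ, ·) = v` (at `t = 0` it is the periodicity of the datum). WHY IT
MIGHT FAIL: uniqueness in the BARE class (pointwise far field per `(t, x)`, no growth class for `ω` or `∇(u,v)`, no bound uniform in
`t`; refuter notes M1/M3, Disproof §4/§7 `UniqueInClass` "doubtful as stated, unrefuted") — a weighted-energy (Gallay–Wayne-type)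
uniqueness proof is expected only ONCE an a-priori bound puts an arbitrary classical solution into a weighted class; that
Täcklind/Tychonoff-type step is the open point. `x`-INDEPENDENT ghosts do not violate this stub (they are `ℓ`-periodic for every `ℓ`),
so it is strictly weaker than full uniqueness. If unprovable in the bare class the repair is ROUTE-level (weighted / bounded-vorticity
side condition on 3007's class); every other stub survives verbatim. SIZE: L–open. Leans on: `InClass`, `IsAdmissiblePerturbation`;
`StretchedLayer.dT_eq_of_subset`, `contDiff_slice`; Mathlib `deriv_comp_add_const`; OU/Gaussian-weight estimates
(`Literature.Analysis.FluidPDE.AncientSimilarityVorticity`). [folklore] -/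
theorem stub_velocityRigidity {ν ℓ : ℝ} {n : ℕ} {θ₁ θ₂ : ℝ → ℝ → ℝ} {u v p : ℝ → ℝ → ℝ → ℝ}
    (hν : 0 < ν) (hℓ : 0 < ℓ) (hn : 1 ≤ n) (hθ : IsAdmissiblePerturbation ℓ θ₁ θ₂)
    (h : InClass ν (n * ℓ) θ₁ θ₂ u v p) :
    ∀ t x y : ℝ, 0 ≤ t → u t (x + ℓ) y = u t x y ∧ v t (x + ℓ) y = v t x y := by
  sorry

/-- **Stub 2 — COARSE CAPTURE (outer half: the contraction/capture lever and the seed; scale `ℓ/4`).**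
For every tolerance `ε > 0` there is `L₀ ∈ (0, 1]` such that for every short period `ℓ ∈ (0, L₀]` there are ONE admissible
`ℓ`-periodic seed `θ = (θ₁, θ₂)` and `ν₀ > 0` such that for all `ν ∈ (0, ν₀]` EVERY classical solution of the class with period `ℓ`
from `U_B^ν + θ` is, from some time `T₁` (depending on everything, `ν` included) on, FOREVER `ε`-captured at radius `ℓ/4`.
MECHANISM (card, "Lever" (1)–(2) and "Why it bites" (ii)–(iv)): the planar carrier field `(u, v − y)` has `div ≡ −1` — material
area shrinks like `e^{−t}`, vorticity of both signs is transported in CONSERVATION form `∂ₜω + div(ω(u, v−y)) = νΔω` into the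
sinks, and a focus that holds the net circulation of its basin is not re-flattened: in the field of a point vortex `κ` plus the
compression, `d(r²)/dt = −2y²`, every particle is captured (the card's `StrainedCapture`, checked by all three triagers; with the
row's midpoint saddle it is capture of a.e. particle, triage r1-1 (b), r1-2 (v)). THREE MONOTONE QUANTITIES available to the
prover: (a) SIGN BUDGET — `∫_cell ω₊` is non-increasing (Kato for the conservation form, no boundaries), so positive vorticity is
only ever annihilated; (b) COMPRESSION — `d/dt∫∫yω = −∫∫yω` (card's `CentroidDecay`, sympy-verified in toy j010730) and
`d/dt∫∫y²|ω| ≤ −2∫∫y²|ω| + 2∫∫y v|ω| + 2ν∫∫|ω|`; (c) `L¹`-contraction of `ω` itself. SEED DESIGNS covered by `∃θ`: (A) the card's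
STRONG SHIELDED FOCUS `θ = ∇⊥χ`, `χ = B·a²Ψ(r/a)η(r/R)` periodised (`−B′` core of radius `a` at the cell centre, `+B′` rim at
`r ≈ R`): formation is perturbative (the weak sheet, circulation `ℓ ≪ B′`, is wound into the focus at once; no linear-instability
phase, so no stable-manifold-of-the-laminar-state issue), the price is DIGESTION of the `+B′` rim (it reaches the axis after
`t ≍ log(R/√ν)` and must annihilate inside the focus — triage r1-3 (2): dipole formation vs diffusive digestion is the untyped risk;
`T₁ = T₁(ℓ, ν)` absorbs it); (B) a WEAK TRIGGER (`B′ ≤ εℓ/2`): the sign budget (a) then holds for ALL times for free, formation is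
Kelvin–Helmholtz roll-up of the cell's fundamental (unstable for `ℓ < π` at small ν — route item `BurgersLayerKH`, Beronov–Kida's
strain-stable band is `λ ≳ π`) in the symmetry-protected cell, and `θ` must avoid the stable manifolds `W^s_ν` of the laminar layer
for all `ν ≤ ν₀` at once (codimension `N(ν) → ∞`, so generic — but to be proved). WHY IT MIGHT FAIL: (1) `∀ t ≥ T₁` — a recurrent
transient (positive remnant forming a dipole with part of the core, or revisits of two-core saddle states) could break capture at
radius `ℓ/4` infinitely often; the liminf only needs capture on a set of times of density → 1, and the lead may weaken the stub to
that (the transfer stub adapts); (2) relaminarisation for a sequence `ν_j → 0` (route's why-might-fail) — excluded for design (A)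
by construction, for (B) only generically; (3) the bare-class issue of Stub 1 (a-priori tails) recurs in every integration by parts.
SIZE: XL (formation from vortex-SHEET data as `ν → 0` has no theory — Delort-type weak limits only; at fixed `ν` it is an ω-limit
statement for one trajectory of a dissipative PDE). Leans on: `InClass`, `IsAdmissiblePerturbation`, `IsCaptured`; tree
`StretchedLayerNS` (class algebra), `BurgersVortexLayer.burgersLayerProfile` (the datum), `GaussianVortexPlanar.biotSavart2D`;
literature Gallay2011 (doi:10.1007/s00205-010-0362-2, interaction of vortices at small ν over finite windows), JacobsPullin1985
(doi:10.1063/1.864953) / BuntinePullin1989 (doi:10.1017/s002211208900203x, merger of strained like-signed vortices), Kawahara2005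
(doi:10.1063/1.1897011, spiral wind-up of a layer by a tube), LinCorcos1984 / Neu1984 (collapse parameter `Γ/(γλ²) = 1/ℓ`, large in
short cells), BeronovKida1996 (doi:10.1063/1.868879, strain-stable band). Cheapest falsifier: the card's short-cell DNS — this unit's batched
toys j013626 / j013718 (ℓ = ½; ν = 2·10⁻³, 10⁻³, 5·10⁻⁴; they print `ε_needed(t)` at `r = ℓ/4`, `|b|/r` and the positive mass —
the clauses of `IsCaptured` — plus the laminar control) and triage toys j010792, j010900: KILL if `ε_needed` does not fall below
`≈ 0.1` by `t ≈ 10` and stay there, or rises again (re-flattening), at the smaller ν. [folklore] -/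
theorem stub_coarseCapture (ε : ℝ) (hε : 0 < ε) :
    ∃ L₀ : ℝ, 0 < L₀ ∧ L₀ ≤ 1 ∧ ∀ ℓ : ℝ, 0 < ℓ → ℓ ≤ L₀ →
      ∃ θ₁ θ₂ : ℝ → ℝ → ℝ, IsAdmissiblePerturbation ℓ θ₁ θ₂ ∧ ∃ ν₀ : ℝ, 0 < ν₀ ∧
        ∀ ν : ℝ, 0 < ν → ν ≤ ν₀ → ∀ u v p : ℝ → ℝ → ℝ → ℝ, InClass ν ℓ θ₁ θ₂ u v p →
          ∃ T₁ : ℝ, ∀ t : ℝ, T₁ ≤ t → IsCaptured ℓ ε (ℓ / 4) (u t) (v t) := by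
  sorry

/-- **Stub 3 — VISCOUS-SCALE CORE (inner half: Burgers concentration with `ν`-uniform constants; HARDEST).**
There are ABSOLUTE constants `ε, ρ₀, κ > 0` such that for every period `ℓ ∈ (0, 1]` there is `ν₁ > 0` with: for all
`ν ∈ (0, ν₁]`, every admissible `θ` and every classical solution of the class with period `ℓ` from `U_B^ν + θ` which is
`ε`-captured at radius `ℓ/4` for all `t ≥ T₁` holds, for all `t ≥` some `T₂ > 0`, circulation `≥ κℓ` in absolute value in SOME box
of half-side `ρ₀√ν`: `κℓ ≤ |Γ_{Q(a(t), b(t), ρ₀√ν)}(t)|`. MECHANISM (card C = `unit-cell-burgers-row-attractor`, reduced to what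
the transfer needs — no steadiness, no spectral statement, no sharp constant): VIRIAL CONTRACTION + AXISYMMETRISATION. For the
captured, essentially one-signed core (`ρ := −ω ≥ 0` of mass `≈ ℓ`) the second moment about the centroid obeys, from the
conservation form, `I′ = 2∫ρ (x−c)·(u, v−y) + 4ν∫ρ`: the compression contributes `−2I_yy`, the self-induced Biot–Savart term
vanishes for the `ℝ²` kernel and is `O(ℓ⁻¹)·(shape anisotropy)·I` for the periodic images (row strain `π/(6ℓ)` on the diagonals,
triage r1-1/r1-3), rotation at rate `≍ ℓ/I ≫ 1/ℓ` equalises `I_xx ≈ I_yy` and averages the deviatoric terms out, so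
`I′ ≈ −I + 4νℓ` and `I → ≍ 4νℓ`; Chebyshev then puts mass `≥ (1 − 4/ρ₀²)ℓ` within radius `ρ₀√ν` (κ = ½, ρ₀ = 3 for the exact
Burgers core `ω ∝ e^{−r²/4ν}`: 89 %). The stabiliser STRENGTHENS as `ν → 0` (core Reynolds number `ℓ/ν → ∞`: enhanced dissipation
/ inviscid damping of non-axisymmetric core modes, Gallay2018, LiWeiZhang2020; Arnold stability GallaySverak2024), every
destabiliser is `ν`-independent and `O(1/ℓ)` (background strain `½`, row strain `π/6ℓ`, remainder-induced strain `≤ 16ε/ℓ` —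
hence an ABSOLUTE `ε`), which is why `κ, ρ₀` uniform in `ℓ ≤ 1` and `ν ≤ ν₁(ℓ) ≲ ℓ²` is the natural truth. THE NAMED OPEN POINT
(card B "Transfer", card C (3), triage r1-1 (a)): with the row strain the core sits in effective asymmetry
`λ_eff(ℓ) = √(1 + (π/3ℓ)²) > 1` (1.45 at ℓ = 1, 2.32 at ℓ = ½, ≈ π/3ℓ for small ℓ) — outside GallayMaekawa2016 Thm 4.1
(`λ < 1`, tree fact `GallayMaekawa2016_thm41`, discharged `_holds`); on `ℝ²` λ > 1 means an exponentially weak leak along the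
extensional axis (MoffattKidaOhkitani1994, ProchazkaPullin1998), in the periodic cell that axis leads into the neighbouring copy
of the same basin (re-capture, which the outer stub books as `∀ t ≥ T₁` capture) — rotation dominates the total strain out to
`r ≈ 0.55ℓ > ℓ/2` (triage r1-2 (viii), r1-3 C3), far beyond `√ν`. WHY IT MIGHT FAIL: `∀ t ≥ T₂` at FIXED box size — a sustained
nutation/elliptic deformation of the core at `λ_eff > 1` (Kida-type) could periodically spill more than `(1−κ)` of the mass out of
any box of half-side `ρ₀√ν`; a time-averaged conclusion would survive and the transfer adapts (lead's reshape option); and the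
a-priori (bare-class) tails issue of Stub 1. SIZE: XL. Leans on: `IsCaptured`, `boxCirc`, `InClass`; tree
`BurgersVortexSteady.burgersVortex_dissipation` (the number `γΓ²/8π`), `GaussianVortexPlanar` (`gaussVortexProfile`,
`strainedVorticityOperator`, `GallayMaekawa2016_thm41`/`_holds` for λ < 1 only), `AncientSimilarityVorticity` (OU dissipativity);
literature GallayMaekawa2016 arXiv:1610.08384 §4 Thm 4.1–4.2, 4.6, Gallay2018 doi:10.1007/s00205-018-1262-0, LiWeiZhang2020
doi:10.24033/asens.2438, GallaySverak2024 doi:10.2140/apde.2024.17.681, MoffattKidaOhkitani1994 doi:10.1017/s002211209400011x,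
ProchazkaPullin1998 doi:10.1017/s0022112098008866. Cheapest falsifier: toys j013626 / j013718 print `f_ρ₀(t)` = (circulation in the box of half-side
`ρ₀√ν` about the core)/(−ℓ) for `ρ₀ = 1…6` at ν = 2·10⁻³, 10⁻³, 5·10⁻⁴: KILL if `f₃` FALLS with ν like the flat layer's `6√ν/ℓ`
(0.54 / 0.38 / 0.27) instead of holding an ν-independent value (`≈ 0.8` expected). [folklore] -/
theorem stub_viscousCore :
    ∃ ε ρ₀ κ : ℝ, 0 < ε ∧ 0 < ρ₀ ∧ 0 < κ ∧ ∀ ℓ : ℝ, 0 < ℓ → ℓ ≤ 1 → ∃ ν₁ : ℝ, 0 < ν₁ ∧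
      ∀ ν : ℝ, 0 < ν → ν ≤ ν₁ → ∀ (θ₁ θ₂ : ℝ → ℝ → ℝ) (u v p : ℝ → ℝ → ℝ → ℝ),
        IsAdmissiblePerturbation ℓ θ₁ θ₂ → InClass ν ℓ θ₁ θ₂ u v p →
        ∀ T₁ : ℝ, (∀ t : ℝ, T₁ ≤ t → IsCaptured ℓ ε (ℓ / 4) (u t) (v t)) →
          ∃ T₂ : ℝ, 0 < T₂ ∧ ∀ t : ℝ, T₂ ≤ t →
            ∃ a b : ℝ, κ * ℓ ≤ |boxCirc (u t) (v t) a b (ρ₀ * Real.sqrt ν)| := by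
  sorry

/-! ## Landed (sorry-free): stubs `stub_pressureRenormalisation` (p88601, `…StubPressureRenormalisation.lean`) and `stub_coreFloor`
(p86383, `…StubCoreFloor.lean`), imported above; reductions `coarseCapture_of_massCapture` (p91001, `…CaptureBookkeeping.lean`:
`stub_coarseCapture ⇐ MassCapture ε`, circulation clause of `IsCaptured` redundant) and `velocityRigidity_of_unique` (p91492,
`…Translate.lean`: `stub_velocityRigidity ⇐` bare-class velocity uniqueness); CONDITIONAL closure `velocityRigidity_of_hasLayerEnergyTails`
(p95051, `…VelocityRigidityEnergy.lean`: `stub_velocityRigidity` holds under the energy-class side condition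
`Literature.Analysis.FluidPDE.StretchedLayer.HasLayerEnergyTails u v`, by the landed Literature theorem
`IsStretchedLayerNSSolutionOn.periodic_of_hasLayerEnergyTails`, p94861) — not usable in this composition because the crux's
class is the bare one; it is what the recommended route-level class repair would consume. -/

/-! ## §3 The composition: the five stubs prove the crux BY NAME (via the landed `StrainedLayerLaw_of_stubs`) -/

/-- **Composition.** The five registered stubs, fed to the landed conditional composition `StrainedLayerLaw_of_stubs`
(`Theorems/MarginalStabilityChainStrainedLayerLawLine.lean`), prove the crux by name. -/
theorem StrainedLayerLaw_of : StrainedLayerLaw :=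
  StrainedLayerLaw_of_stubs
    (fun hν hℓ hn hθ h => stub_velocityRigidity hν hℓ hn hθ h)
    (fun hn h hper => stub_pressureRenormalisation hn h hper)
    stub_coarseCapture stub_viscousCore
    (fun hν hℓ hn hρ hρℓ hΓ₀ hT₂ hreg hper hcore => stub_coreFloor hν hℓ hn hρ hρℓ hΓ₀ hT₂ hreg hper hcore)

end Summit.AnomalousDissipation.AnomalousDissipation.Theorems.StrainedLayerLaw.ContractionCapture

end
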